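import Mathlib
import Summits.Ventures.HodgeRepro.Tier4.Target
import Summits.Ventures.HodgeRepro.Tier4.Line3.DatumOrthVanishing

/-!
# Tier4/Line3/ConeAnn — the linear parts of `f_j`, a cone-annulus of positive measure, and its dilates

Blind re-derivation cell `pub-hodge-repro`, Tier 4 «PROVE THE STEP», LINE L3, seat t4-x2 (g4, reserve wall-breaker),
cut C-L3-HKRAY: the geometric ingredients of the lower Laplace bound (HKRAY-x2.md §5, KMLaplace `KMLaplaceLower`).

`linPart y h := conj h₀ y₀ + conj h₁ y₁` is the linear part of `z ↦ (lift3 z)^* J y` (`jform_lift3_eq_linPart` at a zero `z*`),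
bounded by `(‖y₀‖ + ‖y₁‖) ‖h‖`.  For `y_0, y_1` with `det [y'_0 | y'_1] ≠ 0` there is `κ > 0` such that the CONE-ANNULUS
`coneAnn y₀ y₁ κ := {h : ½ < ‖h‖ < 1, κ‖h‖ < |linPart y_j h|}` is open and non-empty (the Cramer vector with
`linPart y_0 h = linPart y_1 h = 1`), hence of positive Lebesgue measure; its dilate `z* + R·coneAnn` has measure `R⁴` times as
much (`addHaar_preimage_smul`, `finrank ℝ (Fin 2 → ℂ) = 4`).

Nothing here says anything about the status of the Hodge conjecture for CM abelian varieties, which is NOT proved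
(HC_CM is NOT proved by anyone in this repository).
-/

set_option autoImplicit false

noncomputable section

namespace Summit.Ventures.HodgeRepro.Tier4.Line3

open Summit.Ventures.HodgeRepro.Tier4
open Matrix MeasureTheory
open scoped ComplexConjugate

/-- The linear part of `z ↦ (lift3 z)^* J y`: `linPart y h = conj h₀ y₀ + conj h₁ y₁`. -/
def linPart (y : Fin 3 → ℂ) (h : Fin 2 → ℂ) : ℂ := conj (h 0) * y 0 + conj (h 1) * y 1

/-- `linPart` is continuous in `h`. -/
theorem continuous_linPart (y : Fin 3 → ℂ) : Continuous (fun h : Fin 2 → ℂ => linPart y h) := by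
  unfold linPart
  fun_prop

/-- `linPart` is real-homogeneous. -/
theorem linPart_real_smul (y : Fin 3 → ℂ) (t : ℝ) (h : Fin 2 → ℂ) : linPart y ((t : ℂ) • h) = (t : ℂ) * linPart y h := by
  unfold linPart
  simp only [Pi.smul_apply, smul_eq_mul, map_mul, Complex.conj_ofReal]
  ring

/-- At a zero `z*` of `(lift3 ·)^* J y`, the form is `linPart y (z − z*)`. -/
theorem jform_lift3_eq_linPart (y : Fin 3 → ℂ) {zs : Fin 2 → ℂ} (hzs : star (lift3 zs) ⬝ᵥ (J *ᵥ y) = 0)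
    (z : Fin 2 → ℂ) : star (lift3 z) ⬝ᵥ (J *ᵥ y) = linPart y (z - zs) := by
  rw [jform_eq] at hzs ⊢
  simp only [lift3, Matrix.cons_val_zero, Matrix.cons_val_one, Matrix.head_cons, Matrix.cons_val_two,
    Matrix.tail_cons, map_one, one_mul] at hzs ⊢
  unfold linPart
  simp only [Pi.sub_apply, map_sub]
  linear_combination hzs

/-- `|linPart y h| ≤ (‖y₀‖ + ‖y₁‖) ‖h‖`. -/
theorem norm_linPart_le (y : Fin 3 → ℂ) (h : Fin 2 → ℂ) : ‖linPart y h‖ ≤ (‖y 0‖ + ‖y 1‖) * ‖h‖ := by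
  unfold linPart
  calc ‖conj (h 0) * y 0 + conj (h 1) * y 1‖ ≤ ‖conj (h 0) * y 0‖ + ‖conj (h 1) * y 1‖ := norm_add_le _ _
    _ = ‖h 0‖ * ‖y 0‖ + ‖h 1‖ * ‖y 1‖ := by rw [norm_mul, norm_mul, Complex.norm_conj, Complex.norm_conj]
    _ ≤ ‖h‖ * ‖y 0‖ + ‖h‖ * ‖y 1‖ := by
        gcongr
        · exact norm_le_pi_norm h 0
        · exact norm_le_pi_norm h 1
    _ = (‖y 0‖ + ‖y 1‖) * ‖h‖ := by ring

/-- **THE CONE-ANNULUS** `{h : ½ < ‖h‖ < 1, κ‖h‖ < |linPart y_j h|}`. -/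
def coneAnn (y0 y1 : Fin 3 → ℂ) (κ : ℝ) : Set (Fin 2 → ℂ) :=
  {h | 1 / 2 < ‖h‖ ∧ ‖h‖ < 1 ∧ κ * ‖h‖ < ‖linPart y0 h‖ ∧ κ * ‖h‖ < ‖linPart y1 h‖}

/-- The cone-annulus is open. -/
theorem isOpen_coneAnn (y0 y1 : Fin 3 → ℂ) (κ : ℝ) : IsOpen (coneAnn y0 y1 κ) := by
  have h1 : IsOpen {h : Fin 2 → ℂ | 1 / 2 < ‖h‖} := isOpen_lt continuous_const continuous_norm
  have h2 : IsOpen {h : Fin 2 → ℂ | ‖h‖ < 1} := isOpen_lt continuous_norm continuous_const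
  have h3 : IsOpen {h : Fin 2 → ℂ | κ * ‖h‖ < ‖linPart y0 h‖} :=
    isOpen_lt (continuous_const.mul continuous_norm) (continuous_linPart y0).norm
  have h4 : IsOpen {h : Fin 2 → ℂ | κ * ‖h‖ < ‖linPart y1 h‖} :=
    isOpen_lt (continuous_const.mul continuous_norm) (continuous_linPart y1).norm
  have heq : coneAnn y0 y1 κ = {h : Fin 2 → ℂ | 1 / 2 < ‖h‖} ∩ {h | ‖h‖ < 1} ∩ {h | κ * ‖h‖ < ‖linPart y0 h‖} ∩
      {h | κ * ‖h‖ < ‖linPart y1 h‖} := by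
    ext h
    simp only [coneAnn, Set.mem_setOf_eq, Set.mem_inter_iff, and_assoc]
  rw [heq]
  exact ((h1.inter h2).inter h3).inter h4

/-- The cone-annulus lies in the unit ball. -/
theorem coneAnn_subset_ball (y0 y1 : Fin 3 → ℂ) (κ : ℝ) : coneAnn y0 y1 κ ⊆ Metric.ball 0 1 := by
  intro h hh
  rw [Metric.mem_ball, dist_zero_right]
  exact hh.2.1

/-- For independent first coordinates (`det [y'₀ | y'₁] ≠ 0`) the cone-annulus is non-empty for some `κ > 0`. -/
theorem exists_coneAnn_nonempty {y0 y1 : Fin 3 → ℂ} (hab : y0 0 * y1 1 - y0 1 * y1 0 ≠ 0) :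
    ∃ κ : ℝ, 0 < κ ∧ (coneAnn y0 y1 κ).Nonempty := by
  set D : ℂ := y0 0 * y1 1 - y0 1 * y1 0 with hD
  -- the Cramer vector with `linPart y0 h0 = linPart y1 h0 = 1`
  set h0 : Fin 2 → ℂ := ![conj ((y1 1 - y0 1) / D), conj ((y0 0 - y1 0) / D)] with hh0
  have he0 : linPart y0 h0 = 1 := by
    simp only [linPart, hh0, Matrix.cons_val_zero, Matrix.cons_val_one, Complex.conj_conj]
    field_simp
    ring
  have he1 : linPart y1 h0 = 1 := by
    simp only [linPart, hh0, Matrix.cons_val_zero, Matrix.cons_val_one, Complex.conj_conj]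
    field_simp
    ring
  have hn0 : 0 < ‖h0‖ := by
    rw [norm_pos_iff]
    intro h
    rw [h] at he0
    simp [linPart] at he0
  refine ⟨1 / (2 * ‖h0‖), by positivity, ?_⟩
  -- normalise to norm `3/4`
  set t : ℝ := 3 / 4 / ‖h0‖ with ht
  have ht0 : 0 < t := by positivity
  refine ⟨(t : ℂ) • h0, ?_, ?_, ?_, ?_⟩
  · show 1 / 2 < ‖(t : ℂ) • h0‖
    rw [norm_smul, Complex.norm_real, Real.norm_eq_abs, abs_of_pos ht0, ht]
    field_simp
    linarith
  · show ‖(t : ℂ) • h0‖ < 1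
    rw [norm_smul, Complex.norm_real, Real.norm_eq_abs, abs_of_pos ht0, ht]
    field_simp
    linarith
  · show 1 / (2 * ‖h0‖) * ‖(t : ℂ) • h0‖ < ‖linPart y0 ((t : ℂ) • h0)‖
    rw [linPart_real_smul, he0, mul_one, norm_smul, Complex.norm_real, Real.norm_eq_abs, abs_of_pos ht0, ht]
    field_simp
    linarith
  · show 1 / (2 * ‖h0‖) * ‖(t : ℂ) • h0‖ < ‖linPart y1 ((t : ℂ) • h0)‖
    rw [linPart_real_smul, he1, mul_one, norm_smul, Complex.norm_real, Real.norm_eq_abs, abs_of_pos ht0, ht]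
    field_simp
    linarith

/-- The cone-annulus has positive Lebesgue measure when non-empty. -/
theorem measure_coneAnn_pos (y0 y1 : Fin 3 → ℂ) (κ : ℝ) (hne : (coneAnn y0 y1 κ).Nonempty) :
    0 < volume (coneAnn y0 y1 κ) :=
  (isOpen_coneAnn y0 y1 κ).measure_pos volume hne

/-- The cone-annulus has finite measure. -/
theorem measure_coneAnn_lt_top (y0 y1 : Fin 3 → ℂ) (κ : ℝ) : volume (coneAnn y0 y1 κ) < ⊤ :=
  lt_of_le_of_lt (measure_mono (coneAnn_subset_ball y0 y1 κ)) Metric.isBounded_ball.measure_lt_top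

/-- `finrank ℝ (Fin 2 → ℂ) = 4`. -/
theorem finrank_fin2_complex : Module.finrank ℝ (Fin 2 → ℂ) = 4 := by
  rw [Module.finrank_pi_fintype, Complex.finrank_real_complex]
  simp

/-- **THE DILATE** `z* + R · A` of a set `A`, as a preimage: `{z : R⁻¹ (z − z*) ∈ A}`. -/
def dilate (zs : Fin 2 → ℂ) (R : ℝ) (A : Set (Fin 2 → ℂ)) : Set (Fin 2 → ℂ) :=
  (fun z => ((R⁻¹ : ℝ) : ℂ) • (z - zs)) ⁻¹' A

/-- The dilate of an open set is open. -/
theorem isOpen_dilate (zs : Fin 2 → ℂ) (R : ℝ) {A : Set (Fin 2 → ℂ)} (hA : IsOpen A) : IsOpen (dilate zs R A) :=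
  hA.preimage (by fun_prop)

/-- `volume (dilate z* R A) = R⁴ · volume A` for `R > 0`. -/
theorem volume_dilate (zs : Fin 2 → ℂ) {R : ℝ} (hR : 0 < R) (A : Set (Fin 2 → ℂ)) :
    volume (dilate zs R A) = ENNReal.ofReal (R ^ 4) * volume A := by
  have hfun : (fun z : Fin 2 → ℂ => ((R⁻¹ : ℝ) : ℂ) • (z - zs)) =
      (fun w : Fin 2 → ℂ => (R⁻¹ : ℝ) • w) ∘ (fun z => z + (-zs)) := by
    funext z
    ext i
    simp only [Function.comp, Pi.smul_apply, Pi.add_apply, Pi.neg_apply, Pi.sub_apply, smul_eq_mul,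
      Complex.real_smul]
    push_cast
    ring
  unfold dilate
  rw [hfun, Set.preimage_comp, measure_preimage_add_right, Measure.addHaar_preimage_smul volume (inv_ne_zero hR.ne'),
    finrank_fin2_complex]
  congr 2
  rw [inv_pow, inv_inv, abs_of_pos (by positivity)]

/-- Membership in the dilate: `z ∈ dilate z* R A ↔ R⁻¹ (z − z*) ∈ A`. -/
theorem mem_dilate {zs : Fin 2 → ℂ} {R : ℝ} {A : Set (Fin 2 → ℂ)} {z : Fin 2 → ℂ} :
    z ∈ dilate zs R A ↔ ((R⁻¹ : ℝ) : ℂ) • (z - zs) ∈ A := Iff.rfl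

/-- `z − z* = R · (R⁻¹ (z − z*))` for `R > 0`. -/
theorem sub_eq_smul_inv_smul {R : ℝ} (hR : 0 < R) (zs z : Fin 2 → ℂ) :
    z - zs = (R : ℂ) • (((R⁻¹ : ℝ) : ℂ) • (z - zs)) := by
  rw [smul_smul]
  have : (R : ℂ) * ((R⁻¹ : ℝ) : ℂ) = 1 := by
    push_cast
    exact mul_inv_cancel₀ (by exact_mod_cast hR.ne')
  rw [this, one_smul]

end Summit.Ventures.HodgeRepro.Tier4.Line3

end
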